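import Literature.MathematicalPhysics.QuantumFieldTheory.Balaban1983to89.B9Eq352GradLetters
import Literature.MathematicalPhysics.QuantumFieldTheory.Balaban1983to89.B9Ineq368CommSum

/-!
# `Balaban1983to89.B9Eq360VprimeLetters` — B9 p. 402 (3.60): the AVERAGING PART of `V′(A)` as one block-local letter, the
# FULL concrete `V′(A) = V′₁(A) − (F′₂*(A)aQ′(U) + Q′*(U)aF′₂(A) + F′₂*(A)aF′₂(A))` as an `ℝ`-linear operator in gradient form,
# its letter hypotheses `hVg`/`hV0` (with gen 8's `hV1`/`hComm`) as THEOREMS, and (3.68)₃ with every `V′`-letter discharged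

statement-level skeleton of published theorems with citation tags; proofs where landed; nothing here is a claim about the Yang–Mills mass gap

DOCFIX (cell `lit-balaban`, seat r06 gen 15, 2026-08-22; p37 `CITELOC-SWEEP-B4B9.md` §2b page-numeral slips, text layer re-read): (3.57) is p. 401 [PDF 13] ((3.58)–(3.65) p. 402, (3.65)bis–(3.68) p. 403) — the locators of (3.57) in this file corrected accordingly (1 place(s)); declarations, statements and proofs byte-identical to the tree copy of record (p270596).
DOCFIX 2 (r06 gen 16, 2026-08-22, DOC-ONLY; summit-lit1 CITELOC QF48-005, KNOWN row): the p. 403 sentence after (3.68) is now quoted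
print-verbatim («… in terms of the operators introduced until now by writing the expansions of the operators determining P(U′U).»);
the former second half (the list G′(U), G′(U′U), V′, F′₂, C′ plus the words 'and it satisfies the bounds') was this seat's unpacking, now outside the marks (2 places);
declarations, statements and proofs byte-identical to the tree copy.

CITATION HEADER (lean-in-tree rule).  T. Bałaban, *Propagators for lattice gauge theories in a background field*, Commun.
Math. Phys. **99** (1985) 389–434 [Balaban1985BackgroundPropagators] (cell paper B9; `paper:balaban1985-cmp99-background-
propagators`, journal page = PDF page + 388): p. 402 [PDF 14] (3.57)–(3.61) (render `…-p014-x2.png` read as image by this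
seat, 2026-08-21; PRINT: (3.58) «|F′_{2,j}(A; y, x)| ≦ O(1)α₁», «hence finally (Q′_j(U′U)λ)(y) = (Q′_j(U)λ)(y) +
(F′_{2,j}(A)λ)(y), (F′_{2,j}(A)λ)(y) = Σ_{x∈Bʲ(y)} L^{−jd}F′_{2,j}(A; y, x)λ(x), and |(F′_{2,j}(A)λ)(y)| ≦ O(1)α₁(Q′_j|λ|)(y).
(3.59)», «We have a similar expansion for the adjoint operator. We denote operators in this expansion by adding a star as a
superscript. Let us remark that F′*_{2,j}(A) is not an adjoint of F′_{2,j}(A). Combining (3.53) and (3.59) we get Δ_{U′U} +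
Q′*(U′U)aQ′(U′U) = Δ_U + Q′*(U)aQ′(U) − V′₁(A) + F′₂*(A)aQ′(U) + Q′*(U)aF′₂(A) + F′₂*(A)aF′₂(A) = Δ_U + Q′*(U)aQ′(U) −
V′(A), (3.60) where V′(A) is defined by the last equality. It satisfies the bound |(V′(A)λ)(x)| ≦ O(1)α₁((Lʲη)⁻¹|∇_Uλ| +
(Lʲη)⁻²|λ|) (3.61) for x ∈ Bʲ(Λ_j), the norms on the right-hand side restricted to the block Bʲ(y) containing the point
x.»), p. 403 [PDF 15] (3.68) and, after it, «The remainder can be written explicitly in terms of the operators introduced until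
now by writing the expansions of the operators determining P(U′U).» (the list G′(U), G′(U′U), V′, F′₂, C′ is OUR unpacking of «the
operators introduced until now», not printed), p. 394 [PDF 6] (3.24) (the operator `a`), p. 393 [PDF 5] (3.19) (the averaging
operator `Q′_j(U)`), p. 396 [PDF 8] (3.37) («|A′| < α₁(Lʲη)⁻¹, |∇^η_UA′| < α₁(Lʲη)⁻² on Ω_j, j = 0,…,k»), p. 400 [PDF 12]
(3.52)–(3.53) (`V′₁(A)`), p. 405 [PDF 17] (3.73) (the first-order-operator size, of which «V = V⁰ + V¹∇, |V⁰| ≦ O(1)α₁(Lʲη)⁻²,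
|V¹| ≦ O(1)α₁(Lʲη)⁻¹» is this cell's gradient-form READING — the hypothesis shapes `hVg`/`hV0`/`hV1` of the finite-sum
device — not a quotation); [4] = T. Bałaban, *Propagators and renormalization transformations for lattice gauge theories.
II*, Commun. Math. Phys. **96** (1984) 223–250 [Balaban1984PropagatorsII], (2.51)–(2.52) p. 232 (the block-majorant
shape), Lemma 2.1 p. 234; [B8] = T. Bałaban, *Spaces of regular gauge field configurations on a lattice and gauge fixing
conditions*, Commun. Math. Phys. **99** (1985) 75–102 [Balaban1985RegularSpaces], (1.87) p. 91 (the lattice Leibniz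
rule behind the commutator letters).  Cell `lit-balaban`, seat r06 (B9 fold owner) gen 9; SKELETON rows **B9.Eq3.60** ×
**B9.Eq3.68** (× B9.Eq3.50/3.54/3.73 through the imports).  Continuation BY NAME of p06/r06's `B9Eq360Vprime` (v1–v1.3:
`vPrimeOp`, `kerOp`, `liftOp`, `diagOp`, `block`, `norm_vPrimeOp_le` = (3.61), `vPrimeFun`, `vPrimeOp_apply_eq_vPrimeFun`),
of this seat's gen-8 `B9Eq352GradLetters` (`V1pOp` = `V′₁(A)` of (3.52) as an operator, `V0op`, `coefLetter`, `diffLetter`,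
`conj_V1pOp_eq_gradForm`, `hasMajorant_V0op`, `hasMajorant_coefLetter`, `hasMajorant_comm_coefLetter_diffLetter`,
`V1pOp_apply`), `B9Eq352DivFormLetters` (`conj`, `conj_sub`, `hasMajorant_conj_of_local`, `hasMajorant_conj_of_local'`),
`B9Ineq386CommSum` (`hasMajorant_C₃_of_comm_sum`) and `B9Ineq368CommSum` (`ineq368_op_Ds_of_comm_sum`).

WHY.  After gen 8 every `V`-letter hypothesis of the (3.68)₃,₄ / (3.85) finite-sum commutator device was a theorem for the
`V′₁(A)` PART of `V′(A)` only (`B9Eq352GradLetters`, HONEST SCOPE (i)): the full `V′(A)` of (3.60) subtracts the three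
averaging words `F′₂*(A)aQ′(U) + Q′*(U)aF′₂(A) + F′₂*(A)aF′₂(A)`, which the chain `B9Ineq368CommSum.ineq368_op_Ds_of_comm_sum`
sees only inside the zeroth-order letter `V⁰` of `hVg : V′ = V⁰ + Σ_k V¹_k∇_k`.  These words contain no difference operator:
each is a BLOCK-LOCAL bounded operator on the fine-lattice functions (it reads `λ` on the block `Bʲ(y) ∋ x` only), of size
`O(1)·a₀·α₁·(Lʲη)⁻²` by (3.19) (`Σ_{x∈Bʲ(y)}L^{−jd} = 1`), (3.58) (`|F′₂| ≦ O(1)α₁` per kernel entry) and (3.24) (`a = a_j(Lʲη)⁻²`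
on `Λ_j`, `0 ≦ a_j ≦ a₀`) — exactly the three starred terms of the proof of (3.61) in `B9Eq360Vprime.norm_vPrimeOp_le`.  So the
real-coordinate seam `B9Eq352DivFormLetters.hasMajorant_conj_of_local(′)` turns them into one more `(Lʲη)⁻²`-letter of `V⁰`,
and the FULL concrete `V′(A)` — `vPrimeOp (V1pOp η A) …` in p06's block model with the concrete `V′₁(A)` of (3.52) — satisfies
`hVg` and `hV0` as theorems (`hV1`, `hComm` are gen 8's, unchanged: the averaging words do not touch the first-order part).

WHAT THIS FILE PROVES (0 sorry; definitions with bodies + theorems; no `def … : Prop`).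
* §1 `avgOp blk kQ kF sQ sF c` — the averaging part `F′₂*aQ′ + Q′*aF′₂ + F′₂*aF′₂` of (3.60) as ONE `ℝ`-linear operator on
  `X → E` in the block model of `B9Eq360Vprime` (`Q′ = kerOp kQ`, `F′₂ = kerOp kF`, `Q′* = liftOp sQ`, `F′₂* = liftOp sF`, `a =
  diagOp c`); `vPrimeOp_eq_sub_avgOp` (`vPrimeOp V₁ … = V₁ − avgOp …`, `rfl`); `avgOp_apply`; **`norm_avgOp_le`**: under the
  (3.19)/(3.58)/(3.24)-shape kernel bounds (`‖kQ y x‖ ≦ w(y)`, `|B(y)|·w(y) ≦ 1`, `‖kF y x‖ ≦ Cα₁w(y)`, `‖sQ x‖ ≦ 1`, `‖sF x‖ ≦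
  Cα₁`, `|c(y)| ≦ a₀ℓ(y)⁻²`), `‖(avgOp λ)(x)‖ ≦ a₀C(2 + Cα₁)·α₁·ℓ(y_x)⁻²·B` whenever `‖λ‖ ≦ B` on the block of `x` — the starred
  half of (3.61) (= `B9Eq360Vprime.norm_vPrimeOp_le` at `V′₁ := 0`, BY NAME).
* §2 AFTER REAL COORDINATES (`b : Module.Basis ι ℝ E`, `|b.repr v i| ≦ M₂‖v‖`): **`hasMajorant_avgOp'`** (block-diagonal:
  `conj b avgOp ≺ 𝟙[y = y′]·a₀C(2 + Cα₁)α₁ℓ(y)⁻²·M₂Σ_i‖b_i‖`) and **`hasMajorant_avgOp`** (the common decaying shape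
  `a₀C(2 + Cα₁)M₂(Σ_i‖b_i‖)e^{δd₀}·α₁·ℓ⁻²·e^{−δd(y,y′)}` under `d(y,y) ≦ d₀`, `δ ≧ 0`).
* §3 THE FULL CONCRETE `V′(A)`: `vPrimeConc T U η A blk kQ kF sQ sF c := vPrimeOp (V1pOp T U η A) blk kQ kF sQ sF c` — (3.60)
  with the concrete `V′₁(A)` of (3.52); `vPrimeConc_eq` (`= V1pOp − avgOp`); **`vPrimeConc_apply`** (`η ≠ 0`: pointwise it IS
  `B9Eq360Vprime.vPrimeFun` of `B9Eq352ScalarFluct.V1p`, the function for which `B9Eq360Vprime.norm_vPrimeFun_V1p_le` proved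
  (3.61)); **`conj_vPrimeConc_eq_gradForm`** — `hVg` for the full `V′`: `conj b V′ = (conj b V⁰ − conj b avgOp) + Σ_{k∈univ}
  conj b V¹_k * conj b ∇_k`; **`hasMajorant_V0_vPrime`** — `hV0` for the full `V′`: `conj b V⁰ − conj b avgOp ≺ c′_C·α₁·ℓ⁻²·
  e^{−δd}`, `c′_C = ((2 + 8ρ²α₁)d + a₀C(2 + Cα₁))·M₂(Σ_i‖b_i‖)e^{δd₀}`; **`hasMajorant_divForm_zeroth_vPrime`** — the
  zeroth-order operator `C″(A) = (V⁰ − avgOp) + Σ_k[V¹_k, ∇_k]` of the divergence form of the FULL `V′` has the `(Lʲη)⁻²`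
  majorant `((2 + 8ρ²α₁)d + a₀C(2 + Cα₁) + 4dρ²)·M₂(Σ‖b‖)e^{δd₀}·α₁·ℓ⁻²·e^{−δd}` on the concrete carrier.
* §4 **`ineq368_op_Ds_vPrime`** (and, v1.1, its (3.68)₄ twin **`ineq368_op_DDs_vPrime`** with a left end letter `D₀`) —
  `B9Ineq368CommSum.ineq368_op_Ds_of_comm_sum` ((3.68)₃ `P′(A)·D* ≺ κ₃₆₈ᴰ·α₁·(Lʲη)⁻¹·e^{−ρd}`)
  on the carrier `S × ι` with `V := conj b (vPrimeConc …)`, `s := univ : Finset (κ ⊕ κ)` and ALL FOUR `V`-letter hypotheses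
  `hVg`/`hV0`/`hV1`/`hComm` DISCHARGED by §3 and gen 8 (constants `cB_conc`, `cC_conc` explicit); every other letter of the
  chain (Theorem 3.1 entries for `G′(U)`, `G′(U′U)`, the bootstrap `V′E`, `Q′`, `Q′*`, `F′₂`, `F′₂*`, `C⁻¹`, `C′`, the scale
  transfers, (2.54), (2.61)) stays the hypothesis it is in `B9Ineq368CommSum`.

HONEST SCOPE / NOT CLAIMED.  (i) The kernels `kQ`, `kF`, `sQ`, `sF` and the weight `c` are PARAMETERS carrying the printed
bounds (3.19) (`L^{−jd}·|Bʲ(y)| = 1`, transports of norm `≦ 1`), (3.58) (`|F′₂(A;y,x)| ≦ O(1)α₁ =: Cα₁`, likewise for the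
starred kernel) and (3.24) (`0 ≦ a_j ≦ a₀`) as hypotheses, exactly as in `B9Eq360Vprime.norm_vPrimeOp_le`; the
identification of p06's CONCRETE transported averages on the `ℤ^d` carrier (`B9Eq357Levels`/`B9Eq358KeyEstimate`, where
(3.58) is proved) with an instance of these parameters is NOT made here (different carrier; located in `lit-balaban-r06/
INTERFACES-r06.md` §5/§9).  (ii) In §4 the letters `Q`, `Q′`, `F₂`, … of the `P′` words are the chain's abstract
endomorphisms of `S × ι → ℝ` with their own hypotheses; they are not asserted to be the coordinate conjugates of `kerOp kQ`
etc. (those map site functions to block functions; the one-space reading of the chain is `B9Ineq366CPrime` §4/§6's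
business).  (iii) Finite-dimensional `𝔸` with a real basis; `M₂`, `Σ‖b_i‖`, `e^{δd₀}`, `ρ` (transport size; `ρ = 1` for
unitary `U`) are bookkeeping constants invisible in the print's `O(1)`; `d(y,y) ≦ d₀` converts block-diagonal letters to the
common `e^{δd₀}e^{−δd}` shape.  (iv) (3.37) enters blockwise as in `B9Eq352GradLetters` (the scale of the block of `x` for
every letter at `x`).  (v) The vector-side `P₂(A)` of (3.82)–(3.83) is the DIFFERENT (decaying-letter) reading
`B9Ineq385VG.ineq383_op`; nothing here concerns it.  Value = the last located `V`-letter of the (3.68)₃,₄ device is a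
theorem about concrete lattice operators; NOT summit progress.

RELATED IN THE TREE, NOT DUPLICATED (searched 2026-08-21: `lean search 'vPrimeConc|VprimeLetters'` = ∅.
CORRECTION (v1.2, docstrings only): v1/v1.1 of this header also claimed `lean search 'avgOp'` = ∅ — that was FALSE and
is withdrawn: the SHORT name `avgOp` is already used, for the averaging operator `Q`/`Q′` ITSELF, by
`B4GaugeCovariance.avgOp` (matrix form; with API across the B1/B2/B4 files), `B6DomainMajorantSandwich.avgOp`,
`B6Ineq2142.avgOp`, `B9Eq319Avg.avgOp`, `Beta.BulkParametrix.avgOp` (and outside this folder); the present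
`B9Eq360VprimeLetters.avgOp` is a DIFFERENT object — the averaging PART (three words) of the perturbation `V′(A)` of
(3.60), not an averaging operator — living in its own namespace (fully-qualified names do not clash; always refer to
it qualified as `B9Eq360VprimeLetters.avgOp`).  The name is kept because v1.1 dependents (`B9Ineq363Vprime`) use it.
`B9Eq360Vprime.vPrimeOp`/`norm_vPrimeOp_le` give (3.60)/(3.61) for an abstract `V′₁` and are USED here, not restated;
`B9Eq360Vprime.norm_vPrimeFun_V1p_le` is (3.61) for the same concrete function (`vPrimeConc_apply` links to it);
`B9Ineq385VG.ineq383_op` majorises the vector-side averaging words from decaying letters; `B9Eq352GradLetters` has the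
`V′₁` letters).
-/

noncomputable section

namespace Literature.MathematicalPhysics.QuantumFieldTheory.Balaban1983to89.B9Eq360VprimeLetters

open Literature.MathematicalPhysics.QuantumFieldTheory.Balaban1983to89
open Literature.MathematicalPhysics.QuantumFieldTheory.Balaban1983to89.B6RandomWalk (HasMajorant hasMajorant_mono
  hasMajorant_add Triangle254 Ineq261)
open Literature.MathematicalPhysics.QuantumFieldTheory.Balaban1983to89.B9Thm34Ext (toB6)
open Literature.MathematicalPhysics.QuantumFieldTheory.Balaban1983to89.B9Ineq347 (ScaleTransfer)
open Literature.MathematicalPhysics.QuantumFieldTheory.Balaban1983to89.B9Eq39Adjoint (covD covDstar)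
open Literature.MathematicalPhysics.QuantumFieldTheory.Balaban1983to89.B9Eq360Vprime (kerOp liftOp diagOp vPrimeOp
  vPrimeOp_apply norm_vPrimeOp_le vPrimeFun vPrimeOp_apply_eq_vPrimeFun liftOp_apply diagOp_apply)
open Literature.MathematicalPhysics.QuantumFieldTheory.Balaban1983to89.B9Eq352ScalarFluct (V1p)
open Literature.MathematicalPhysics.QuantumFieldTheory.Balaban1983to89.B9Eq352DivForm (tauB)
open Literature.MathematicalPhysics.QuantumFieldTheory.Balaban1983to89.B9Eq352DivFormLetters (conj conj_sub conj_mul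
  hasMajorant_conj_of_local hasMajorant_conj_of_local')
open Literature.MathematicalPhysics.QuantumFieldTheory.Balaban1983to89.B9Eq352GradLetters (V1pOp V0op coefLetter
  diffLetter V1pOp_eq_gradForm conj_V1pOp_eq_gradForm hasMajorant_V0op hasMajorant_coefLetter
  hasMajorant_comm_coefLetter_diffLetter V1pOp_apply)
open Literature.MathematicalPhysics.QuantumFieldTheory.Balaban1983to89.B9Ineq368PPrime (hasMajorant_neg hasMajorant_sub)
open Literature.MathematicalPhysics.QuantumFieldTheory.Balaban1983to89.B9Ineq368PPrimeDs (kappa368Ds)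
open Literature.MathematicalPhysics.QuantumFieldTheory.Balaban1983to89.B9Ineq386CommSum (hasMajorant_C₃_of_comm_sum)
open Literature.MathematicalPhysics.QuantumFieldTheory.Balaban1983to89.B9Ineq368CommSum (ineq368_op_Ds_of_comm_sum
  ineq368_op_DDs_of_comm_sum)

/-! ## §1  The averaging part of (3.60) as one block-local operator, and its pointwise size -/

section AvgOp

variable {X S : Type*} [Fintype X] [DecidableEq S]
variable {E : Type*} [NormedAddCommGroup E] [NormedSpace ℝ E]

/-- **The averaging part of `V′(A)`** (3.60): `F′₂*(A)aQ′(U) + Q′*(U)aF′₂(A) + F′₂*(A)aF′₂(A)` as ONE `ℝ`-linear operator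
on the fine-lattice functions, in the block model of `B9Eq360Vprime` (`Q′(U) = kerOp kQ`, `F′₂(A) = kerOp kF`, `Q′*(U) =
liftOp sQ`, `F′₂*(A) = liftOp sF`, `a = diagOp c`); `V′(A) = V′₁(A) − avgOp` (`vPrimeOp_eq_sub_avgOp`).
(v1.2 naming note: NOT an averaging operator — the unrelated decls `B4GaugeCovariance.avgOp`,
`B6DomainMajorantSandwich.avgOp`, `B6Ineq2142.avgOp`, `B9Eq319Avg.avgOp`, `Beta.BulkParametrix.avgOp` ARE the
averaging operators `Q`/`Q′` themselves; refer to this one qualified.)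
[cite: Balaban1985BackgroundPropagators, (3.60) p.402 + (3.57) p.401 + (3.24) p.394] -/
def avgOp (blk : X → S) (kQ kF : S → X → E →L[ℝ] E) (sQ sF : X → E →L[ℝ] E) (c : S → ℝ) :
    Module.End ℝ (X → E) :=
  liftOp blk sF ∘ₗ diagOp c ∘ₗ kerOp blk kQ + liftOp blk sQ ∘ₗ diagOp c ∘ₗ kerOp blk kF
    + liftOp blk sF ∘ₗ diagOp c ∘ₗ kerOp blk kF

/-- **(3.60)**: `V′(A) = V′₁(A) − (F′₂*aQ′ + Q′*aF′₂ + F′₂*aF′₂)`, i.e. `vPrimeOp V₁ … = V₁ − avgOp …` (definitional).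
[cite: Balaban1985BackgroundPropagators, (3.60) p.402] -/
theorem vPrimeOp_eq_sub_avgOp (V₁ : Module.End ℝ (X → E)) (blk : X → S) (kQ kF : S → X → E →L[ℝ] E)
    (sQ sF : X → E →L[ℝ] E) (c : S → ℝ) :
    vPrimeOp V₁ blk kQ kF sQ sF c = V₁ - avgOp blk kQ kF sQ sF c := rfl

/-- The three starred terms of (3.60) at a point `x` (block `y = y_x`):
`(avgOp λ)(x) = sF(x)(c(y)·(Q′λ)(y)) + sQ(x)(c(y)·(F′₂λ)(y)) + sF(x)(c(y)·(F′₂λ)(y))`.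
[cite: Balaban1985BackgroundPropagators, (3.60) p.402] -/
theorem avgOp_apply (blk : X → S) (kQ kF : S → X → E →L[ℝ] E) (sQ sF : X → E →L[ℝ] E) (c : S → ℝ)
    (μ : X → E) (x : X) :
    avgOp blk kQ kF sQ sF c μ x
      = sF x (c (blk x) • kerOp blk kQ μ (blk x)) + sQ x (c (blk x) • kerOp blk kF μ (blk x))
        + sF x (c (blk x) • kerOp blk kF μ (blk x)) := by
  simp only [avgOp, LinearMap.add_apply, LinearMap.comp_apply, Pi.add_apply, liftOp_apply, diagOp_apply]

/-- **THE STARRED HALF OF (3.61)**: under the (3.19)/(3.58)/(3.24)-shape kernel bounds — `‖kQ y x‖ ≦ w(y)` with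
`|B(y)|·w(y) ≦ 1` (`w = L^{−jd}`, unit transports), `‖kF y x‖ ≦ Cα₁w(y)` ((3.58), `C` = its `O(1)`), `‖sQ x‖ ≦ 1`, `‖sF x‖ ≦
Cα₁`, `|c(y)| ≦ a₀ℓ(y)⁻²` ((3.24), `0 ≦ a_j ≦ a₀`) — the averaging part is a block-local letter of size `(Lʲη)⁻²`:
`‖(avgOp λ)(x)‖ ≦ a₀C(2 + Cα₁)·α₁·ℓ(y_x)⁻²·B` whenever `‖λ‖ ≦ B` on the block of `x` (*"the norms on the right-hand side
restricted to the block Bʲ(y) containing the point x"*).  `B9Eq360Vprime.norm_vPrimeOp_le` at `V′₁ := 0` BY NAME.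
[cite: Balaban1985BackgroundPropagators, (3.61) p.402 + (3.58)–(3.59) p.402 + (3.19) p.393 + (3.24) p.394] -/
theorem norm_avgOp_le (blk : X → S) (kQ kF : S → X → E →L[ℝ] E) (sQ sF : X → E →L[ℝ] E) (c : S → ℝ)
    (len w : S → ℝ) (C α₁ a₀ : ℝ) (hlen : ∀ y, 0 < len y) (hw : ∀ y, 0 ≤ w y)
    (hcard : ∀ y, ((B9Eq360Vprime.block blk y).card : ℝ) * w y ≤ 1) (hC : 0 ≤ C) (hα : 0 ≤ α₁) (ha₀ : 0 ≤ a₀)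
    (hkQ : ∀ y x, blk x = y → ‖kQ y x‖ ≤ w y) (hkF : ∀ y x, blk x = y → ‖kF y x‖ ≤ C * α₁ * w y)
    (hsQ : ∀ x, ‖sQ x‖ ≤ 1) (hsF : ∀ x, ‖sF x‖ ≤ C * α₁) (hc : ∀ y, |c y| ≤ a₀ * (len y ^ 2)⁻¹)
    (μ : X → E) (x : X) (B : ℝ) (hB : ∀ x', blk x' = blk x → ‖μ x'‖ ≤ B) :
    ‖avgOp blk kQ kF sQ sF c μ x‖ ≤ a₀ * C * (2 + C * α₁) * α₁ * (len (blk x) ^ 2)⁻¹ * B := by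
  have h := norm_vPrimeOp_le (0 : Module.End ℝ (X → E)) blk kQ kF sQ sF c (0 : (X → E) →ₗ[ℝ] (X → E))
    (fun _ _ => False) (fun _ _ => False) len w 0 0 C α₁ a₀ hlen hw hcard hC hα ha₀
    (fun μ x B₁ B₂ _ _ => by simp) hkQ hkF hsQ hsF hc μ x 0 B (fun _ h => h.elim) (fun _ h => h.elim) hB
  have h0 : vPrimeOp (0 : Module.End ℝ (X → E)) blk kQ kF sQ sF c μ x = -(avgOp blk kQ kF sQ sF c μ x) := by
    rw [vPrimeOp_eq_sub_avgOp, zero_sub, LinearMap.neg_apply, Pi.neg_apply]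
  rw [h0, norm_neg] at h
  refine h.trans (le_of_eq ?_)
  ring

end AvgOp

/-! ## §2  After real coordinates: the averaging part is one more `(Lʲη)⁻²`-letter of the block-majorant calculus -/

section Coord

variable {E : Type*} [NormedAddCommGroup E] [NormedSpace ℝ E] {ι : Type} [Fintype ι] (b : Module.Basis ι ℝ E)
variable {S : Type} [Fintype S]
variable {g : B9.Geometry} [Fintype g.Site] [DecidableEq g.Site] {Rr : ℝ} {H : Prop}

/-- **The averaging part after coordinates, block-diagonal form**: `conj b avgOp ≺ 𝟙[y = y′]·(a₀C(2 + Cα₁)·α₁·ℓ(y)⁻²)·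
M₂(Σ_i‖b_i‖)` (it reads and writes inside one block). [cite: Balaban1985BackgroundPropagators, (3.60)–(3.61) p.402; Balaban1984PropagatorsII, (2.51) p.232] -/
theorem hasMajorant_avgOp' (blk : S → g.Site) (kQ kF : g.Site → S → E →L[ℝ] E) (sQ sF : S → E →L[ℝ] E)
    (c w : g.Site → ℝ) (C α₁ a₀ M₂ : ℝ) (hw : ∀ y, 0 ≤ w y) (hcard : ∀ y, ((B9Eq360Vprime.block blk y).card : ℝ) * w y ≤ 1)
    (hC : 0 ≤ C) (hα : 0 ≤ α₁) (ha₀ : 0 ≤ a₀) (hM₂ : 0 ≤ M₂) (hrepr : ∀ (v : E) (i : ι), |b.repr v i| ≤ M₂ * ‖v‖)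
    (hlen : ∀ y : g.Site, 0 < g.len y)
    (hkQ : ∀ y x, blk x = y → ‖kQ y x‖ ≤ w y) (hkF : ∀ y x, blk x = y → ‖kF y x‖ ≤ C * α₁ * w y)
    (hsQ : ∀ x, ‖sQ x‖ ≤ 1) (hsF : ∀ x, ‖sF x‖ ≤ C * α₁) (hc : ∀ y, |c y| ≤ a₀ * (g.len y ^ 2)⁻¹) :
    HasMajorant (g := toB6 g Rr H) (fun p : S × ι => blk p.1) (conj b (avgOp blk kQ kF sQ sF c))
      (fun a a' : g.Site =>
        if a = a' then a₀ * C * (2 + C * α₁) * α₁ * (g.len a ^ 2)⁻¹ * (M₂ * ∑ i, ‖b i‖) else 0) :=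
  hasMajorant_conj_of_local' (Rr := Rr) (H := H) b blk (fun x x' => blk x' = blk x)
    (fun a => a₀ * C * (2 + C * α₁) * α₁ * (g.len a ^ 2)⁻¹) M₂ hM₂ hrepr (fun _ _ h => h)
    (avgOp blk kQ kF sQ sF c)
    fun f x B hB => norm_avgOp_le blk kQ kF sQ sF c g.len w C α₁ a₀ hlen hw hcard hC hα ha₀ hkQ hkF hsQ hsF hc f x B hB

/-- **The averaging part after coordinates, common decaying shape**: under `d(y,y) ≦ d₀` and `δ ≧ 0`,
`conj b avgOp ≺ a₀C(2 + Cα₁)M₂(Σ_i‖b_i‖)e^{δd₀}·α₁·ℓ(y)⁻²·e^{−δd(y,y′)}` — the shape of the zeroth-order letter `hV0` of the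
finite-sum device. [cite: Balaban1985BackgroundPropagators, (3.60)–(3.61) p.402; Balaban1984PropagatorsII, (2.51) p.232] -/
theorem hasMajorant_avgOp (blk : S → g.Site) (kQ kF : g.Site → S → E →L[ℝ] E) (sQ sF : S → E →L[ℝ] E)
    (c w : g.Site → ℝ) (C α₁ a₀ M₂ d₀ δ : ℝ) (hw : ∀ y, 0 ≤ w y) (hcard : ∀ y, ((B9Eq360Vprime.block blk y).card : ℝ) * w y ≤ 1)
    (hC : 0 ≤ C) (hα : 0 ≤ α₁) (ha₀ : 0 ≤ a₀) (hM₂ : 0 ≤ M₂) (hrepr : ∀ (v : E) (i : ι), |b.repr v i| ≤ M₂ * ‖v‖)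
    (hlen : ∀ y : g.Site, 0 < g.len y) (hδ : 0 ≤ δ) (hd₀0 : ∀ y : g.Site, g.dist y y ≤ d₀)
    (hkQ : ∀ y x, blk x = y → ‖kQ y x‖ ≤ w y) (hkF : ∀ y x, blk x = y → ‖kF y x‖ ≤ C * α₁ * w y)
    (hsQ : ∀ x, ‖sQ x‖ ≤ 1) (hsF : ∀ x, ‖sF x‖ ≤ C * α₁) (hc : ∀ y, |c y| ≤ a₀ * (g.len y ^ 2)⁻¹) :
    HasMajorant (g := toB6 g Rr H) (fun p : S × ι => blk p.1) (conj b (avgOp blk kQ kF sQ sF c))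
      (fun y y' => (a₀ * C * (2 + C * α₁) * M₂ * (∑ i, ‖b i‖) * Real.exp (δ * d₀)) * α₁ * (g.len y ^ 2)⁻¹ *
        Real.exp (-(δ * g.dist y y'))) := by
  have hc0 : ∀ y : g.Site, 0 ≤ a₀ * C * (2 + C * α₁) * α₁ * (g.len y ^ 2)⁻¹ := fun y => by
    have := hlen y
    positivity
  refine hasMajorant_mono (g := toB6 g Rr H) _
    (hasMajorant_conj_of_local (Rr := Rr) (H := H) b blk (fun x x' => blk x' = blk x)
      (fun a => a₀ * C * (2 + C * α₁) * α₁ * (g.len a ^ 2)⁻¹) d₀ δ M₂ hc0 hδ hM₂ hrepr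
      (fun x x' h => by rw [h]; exact hd₀0 _) (avgOp blk kQ kF sQ sF c)
      fun f x B hB => norm_avgOp_le blk kQ kF sQ sF c g.len w C α₁ a₀ hlen hw hcard hC hα ha₀ hkQ hkF hsQ hsF hc f x
        B hB)
    fun y y' => le_of_eq ?_
  ring

end Coord

/-! ## §3  The full concrete `V′(A)` of (3.60): definition, gradient form `hVg`, and the zeroth-order size `hV0` -/

section Full

variable {𝔸 : Type*} [NormedRing 𝔸] [NormedAlgebra ℂ 𝔸] {ι : Type} [Fintype ι]
variable (b : Module.Basis ι ℝ 𝔸) {S : Type} [Fintype S] {κ : Type} [Fintype κ]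
variable (T : κ → Equiv.Perm S) (U : κ → S → 𝔸ˣ)

/-- **THE FULL `V′(A)` OF (3.60) ON THE CONCRETE CARRIER**: `V′(A) = V′₁(A) − (F′₂*(A)aQ′(U) + Q′*(U)aF′₂(A) +
F′₂*(A)aF′₂(A))` with the concrete `V′₁(A) = V1pOp T U η A` of (3.52) (`B9Eq352GradLetters`) and the averaging letters in
the block model of `B9Eq360Vprime` (blocks `𝔅`, block map `blk`, kernels `kQ`, `kF`, `sQ`, `sF`, weight `c`).
[cite: Balaban1985BackgroundPropagators, (3.60) p.402 + (3.52)–(3.53) p.400] -/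
def vPrimeConc {𝔅 : Type*} [DecidableEq 𝔅] (η : ℝ) (A : κ → S → 𝔸) (blk : S → 𝔅) (kQ kF : 𝔅 → S → 𝔸 →L[ℝ] 𝔸)
    (sQ sF : S → 𝔸 →L[ℝ] 𝔸) (c : 𝔅 → ℝ) : Module.End ℝ (S → 𝔸) :=
  vPrimeOp (V1pOp T U η A) blk kQ kF sQ sF c

/-- `V′(A) = V′₁(A) − avgOp` for the concrete operator. [cite: Balaban1985BackgroundPropagators, (3.60) p.402] -/
theorem vPrimeConc_eq {𝔅 : Type*} [DecidableEq 𝔅] (η : ℝ) (A : κ → S → 𝔸) (blk : S → 𝔅)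
    (kQ kF : 𝔅 → S → 𝔸 →L[ℝ] 𝔸) (sQ sF : S → 𝔸 →L[ℝ] 𝔸) (c : 𝔅 → ℝ) :
    vPrimeConc T U η A blk kQ kF sQ sF c = V1pOp T U η A - avgOp blk kQ kF sQ sF c := rfl

/-- **Pointwise, `vPrimeConc` IS the (3.60)-function of the concrete `V′₁`** (`η ≠ 0`): `(V′(A)λ)(x) = vPrimeFun (V′₁(A)) … λ x`
with `V′₁ = B9Eq352ScalarFluct.V1p` — the function for which `B9Eq360Vprime.norm_vPrimeFun_V1p_le` is (3.61).
[cite: Balaban1985BackgroundPropagators, (3.60)–(3.61) p.402 + (3.52)–(3.53) p.400] -/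
theorem vPrimeConc_apply {𝔅 : Type*} [DecidableEq 𝔅] (η : ℝ) (hη : η ≠ 0) (A : κ → S → 𝔸) (blk : S → 𝔅)
    (kQ kF : 𝔅 → S → 𝔸 →L[ℝ] 𝔸) (sQ sF : S → 𝔸 →L[ℝ] 𝔸) (c : 𝔅 → ℝ) (μ : S → 𝔸) (x : S) :
    vPrimeConc T U η A blk kQ kF sQ sF c μ x = vPrimeFun (fun ν z => V1p T U η A ν z) blk kQ kF sQ sF c μ x := by
  rw [vPrimeConc, vPrimeOp_apply_eq_vPrimeFun]
  simp only [vPrimeFun, V1pOp_apply T U η hη]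

/-- **`hVg` FOR THE FULL CONCRETE `V′(A)`**: after coordinates,
`conj b V′(A) = (conj b V⁰ − conj b avgOp) + Σ_{k∈univ} conj b (V¹_k) * conj b (∇_k)` — the gradient-form hypothesis of
`B9Ineq368CommSum.ineq368_op_Ds_of_comm_sum` / `B9Ineq386CommSum.hasMajorant_GV_of_gradForm_comm_sum` with `V0 := conj b V⁰ −
conj b avgOp`, `V1 k := conj b (coefLetter A k)`, `D k := conj b (diffLetter η⁻¹ k)`, `s := univ` (the averaging words carry
no difference operator, so they join `V⁰`). [cite: Balaban1985BackgroundPropagators, (3.60) p.402 + (3.52) p.400 + (3.73) p.405; Balaban1984PropagatorsII, (2.52) p.232] -/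
theorem conj_vPrimeConc_eq_gradForm {𝔅 : Type*} [DecidableEq 𝔅] (η : ℝ) (A : κ → S → 𝔸) (blk : S → 𝔅)
    (kQ kF : 𝔅 → S → 𝔸 →L[ℝ] 𝔸) (sQ sF : S → 𝔸 →L[ℝ] 𝔸) (c : 𝔅 → ℝ) :
    conj b (vPrimeConc T U η A blk kQ kF sQ sF c)
      = (conj b (V0op T U η A) - conj b (avgOp blk kQ kF sQ sF c))
        + ∑ k ∈ Finset.univ, conj b (coefLetter T U A k) * conj b (diffLetter T U ((η : ℂ)⁻¹) k) := by
  rw [vPrimeConc_eq, conj_sub, conj_V1pOp_eq_gradForm]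
  abel

variable [CompleteSpace 𝔸] {g : B9.Geometry} [Fintype g.Site] [DecidableEq g.Site] {Rr : ℝ} {H : Prop}

/-- **`hV0` FOR THE FULL CONCRETE `V′(A)`**: under (3.37) read blockwise for the letters of `V⁰` as they occur (as in
`B9Eq352GradLetters.hasMajorant_V0op`) and the (3.19)/(3.58)/(3.24)-shape kernel bounds of the averaging letters,
`conj b V⁰ − conj b avgOp ≺ c′_C·α₁·ℓ⁻²·e^{−δd(y,y′)}` with
`c′_C = ((2 + 8ρ²α₁)·d + a₀C(2 + Cα₁))·M₂(Σ_i‖b_i‖)·e^{δd₀}` — the zeroth-order size `|V⁰| ≦ O(1)α₁(Lʲη)⁻²` (gradient-form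
reading of (3.73)/(3.61)) for the FULL `V′` of (3.60).
[cite: Balaban1985BackgroundPropagators, (3.60)–(3.61) p.402 + (3.52) p.400 + (3.37) p.396; Balaban1984PropagatorsII, (2.51)–(2.52) p.232] -/
theorem hasMajorant_V0_vPrime (blk : S → g.Site) {η : ℝ} (hη : 0 < η) (A : κ → S → 𝔸)
    (kQ kF : g.Site → S → 𝔸 →L[ℝ] 𝔸) (sQ sF : S → 𝔸 →L[ℝ] 𝔸) (c w : g.Site → ℝ) (ρ d₀ δ M₂ α₁ C a₀ : ℝ)
    (hα₁ : 0 ≤ α₁) (hδ : 0 ≤ δ) (hM₂ : 0 ≤ M₂) (hrepr : ∀ (v : 𝔸) (i : ι), |b.repr v i| ≤ M₂ * ‖v‖)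
    (hlen : ∀ y : g.Site, 0 < g.len y) (hsmall : ∀ y : g.Site, η * (α₁ * (g.len y)⁻¹) ≤ 1 / 4)
    (hA : ∀ μ x, ‖A μ x‖ ≤ α₁ * (g.len (blk x))⁻¹ ∧ ‖tauB T U μ (A μ) x‖ ≤ α₁ * (g.len (blk x))⁻¹)
    (h337s : ∀ μ x, ‖((η : ℂ)⁻¹) • covDstar T U μ (A μ) x‖ ≤ α₁ * (g.len (blk x) ^ 2)⁻¹)
    (hρ : ∀ μ x, ‖((U μ x : 𝔸ˣ) : 𝔸)‖ ≤ ρ ∧ ‖(((U μ x)⁻¹ : 𝔸ˣ) : 𝔸)‖ ≤ ρ)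
    (hd₀ : ∀ μ x, g.dist (blk x) (blk (T μ x)) ≤ d₀ ∧ g.dist (blk x) (blk ((T μ).symm x)) ≤ d₀)
    (hd₀0 : ∀ y : g.Site, g.dist y y ≤ d₀)
    (hw : ∀ y, 0 ≤ w y) (hcard : ∀ y, ((B9Eq360Vprime.block blk y).card : ℝ) * w y ≤ 1) (hC : 0 ≤ C) (ha₀ : 0 ≤ a₀)
    (hkQ : ∀ y x, blk x = y → ‖kQ y x‖ ≤ w y) (hkF : ∀ y x, blk x = y → ‖kF y x‖ ≤ C * α₁ * w y)
    (hsQ : ∀ x, ‖sQ x‖ ≤ 1) (hsF : ∀ x, ‖sF x‖ ≤ C * α₁) (hc : ∀ y, |c y| ≤ a₀ * (g.len y ^ 2)⁻¹) :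
    HasMajorant (g := toB6 g Rr H) (fun p : S × ι => blk p.1)
      (conj b (V0op T U η A) - conj b (avgOp blk kQ kF sQ sF c))
      (fun y y' => (((2 + 8 * ρ ^ 2 * α₁) * Fintype.card κ + a₀ * C * (2 + C * α₁)) * M₂ * (∑ i, ‖b i‖) *
          Real.exp (δ * d₀)) * α₁ * (g.len y ^ 2)⁻¹ * Real.exp (-(δ * g.dist y y'))) := by
  refine hasMajorant_mono (g := toB6 g Rr H) _
    (hasMajorant_sub (R := Rr) (H := H) _
      (hasMajorant_V0op b T U blk hη A ρ d₀ δ M₂ α₁ hα₁ hδ hM₂ hrepr hlen hsmall hA h337s hρ hd₀ hd₀0)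
      (hasMajorant_avgOp b blk kQ kF sQ sF c w C α₁ a₀ M₂ d₀ δ hw hcard hC hα₁ ha₀ hM₂ hrepr hlen hδ hd₀0 hkQ hkF hsQ
        hsF hc))
    fun y y' => le_of_eq ?_
  ring

/-- **THE ZEROTH-ORDER OPERATOR OF THE DIVERGENCE FORM OF THE FULL `V′(A)`**: `C″(A) := (V⁰ − avgOp) + Σ_k [V¹_k, ∇_k]`
(so that `V′ = Σ_k ∇_kV¹_k + C″`, `B9Ineq386CommSum.divForm_of_gradForm_sum` on `conj_vPrimeConc_eq_gradForm`) satisfies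
`conj-level C″ ≺ c·α₁·(Lʲη)⁻²·e^{−δd}`, `c = ((2 + 8ρ²α₁)·d + a₀C(2 + Cα₁) + 4dρ²)·M₂(Σ_i‖b_i‖)e^{δd₀}` — the divergence-form
reading of (3.60)–(3.61) (with the commutators `[V¹,∇]` of [B8] (1.87) of size (3.37)) as a theorem about the concrete lattice
operators (`B9Ineq386CommSum.hasMajorant_C₃_of_comm_sum` fed with `hasMajorant_V0_vPrime` and gen 8's
`hasMajorant_comm_coefLetter_diffLetter`).
[cite: Balaban1985BackgroundPropagators, (3.60)–(3.61) p.402 + (3.52) p.400 + (3.37) p.396; Balaban1985RegularSpaces, (1.87) p.91; Balaban1984PropagatorsII, (2.51)–(2.52) p.232] -/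
theorem hasMajorant_divForm_zeroth_vPrime (blk : S → g.Site) {η : ℝ} (hη : 0 < η) (A : κ → S → 𝔸)
    (kQ kF : g.Site → S → 𝔸 →L[ℝ] 𝔸) (sQ sF : S → 𝔸 →L[ℝ] 𝔸) (c w : g.Site → ℝ) (ρ d₀ δ M₂ α₁ C a₀ : ℝ)
    (hα₁ : 0 ≤ α₁) (hδ : 0 ≤ δ) (hM₂ : 0 ≤ M₂) (hrepr : ∀ (v : 𝔸) (i : ι), |b.repr v i| ≤ M₂ * ‖v‖)
    (hlen : ∀ y : g.Site, 0 < g.len y) (hsmall : ∀ y : g.Site, η * (α₁ * (g.len y)⁻¹) ≤ 1 / 4)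
    (hA : ∀ μ x, ‖A μ x‖ ≤ α₁ * (g.len (blk x))⁻¹ ∧ ‖tauB T U μ (A μ) x‖ ≤ α₁ * (g.len (blk x))⁻¹)
    (h337s : ∀ μ x, ‖((η : ℂ)⁻¹) • covDstar T U μ (A μ) x‖ ≤ α₁ * (g.len (blk x) ^ 2)⁻¹)
    (h337F : ∀ μ x, ‖((η : ℂ)⁻¹) • covD T U μ (A μ) x‖ ≤ α₁ * (g.len (blk x) ^ 2)⁻¹)
    (h337B : ∀ μ x, ‖((η : ℂ)⁻¹) • covDstar T U μ (tauB T U μ (A μ)) x‖ ≤ α₁ * (g.len (blk x) ^ 2)⁻¹)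
    (hρ : ∀ μ x, ‖((U μ x : 𝔸ˣ) : 𝔸)‖ ≤ ρ ∧ ‖(((U μ x)⁻¹ : 𝔸ˣ) : 𝔸)‖ ≤ ρ)
    (hd₀ : ∀ μ x, g.dist (blk x) (blk (T μ x)) ≤ d₀ ∧ g.dist (blk x) (blk ((T μ).symm x)) ≤ d₀)
    (hd₀0 : ∀ y : g.Site, g.dist y y ≤ d₀)
    (hw : ∀ y, 0 ≤ w y) (hcard : ∀ y, ((B9Eq360Vprime.block blk y).card : ℝ) * w y ≤ 1) (hC : 0 ≤ C) (ha₀ : 0 ≤ a₀)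
    (hkQ : ∀ y x, blk x = y → ‖kQ y x‖ ≤ w y) (hkF : ∀ y x, blk x = y → ‖kF y x‖ ≤ C * α₁ * w y)
    (hsQ : ∀ x, ‖sQ x‖ ≤ 1) (hsF : ∀ x, ‖sF x‖ ≤ C * α₁) (hc : ∀ y, |c y| ≤ a₀ * (g.len y ^ 2)⁻¹) :
    HasMajorant (g := toB6 g Rr H) (fun p : S × ι => blk p.1)
      ((conj b (V0op T U η A) - conj b (avgOp blk kQ kF sQ sF c))
        + ∑ k ∈ Finset.univ, (conj b (coefLetter T U A k) * conj b (diffLetter T U ((η : ℂ)⁻¹) k)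
            - conj b (diffLetter T U ((η : ℂ)⁻¹) k) * conj b (coefLetter T U A k)))
      (fun y y' => ((((2 + 8 * ρ ^ 2 * α₁) * Fintype.card κ + a₀ * C * (2 + C * α₁)) + 4 * Fintype.card κ * ρ ^ 2)
          * M₂ * (∑ i, ‖b i‖) * Real.exp (δ * d₀)) * α₁ * (g.len y ^ 2)⁻¹ * Real.exp (-(δ * g.dist y y'))) := by
  have h := hasMajorant_C₃_of_comm_sum (R := Rr) (H := H) (fun p : S × ι => blk p.1) (Finset.univ : Finset (κ ⊕ κ)) δ
    (((2 + 8 * ρ ^ 2 * α₁) * Fintype.card κ + a₀ * C * (2 + C * α₁)) * M₂ * (∑ i, ‖b i‖) * Real.exp (δ * d₀)) α₁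
    (fun _ => 2 * ρ ^ 2 * M₂ * (∑ i, ‖b i‖) * Real.exp (δ * d₀))
    (V1 := fun k => conj b (coefLetter T U A k)) (D := fun k => conj b (diffLetter T U ((η : ℂ)⁻¹) k))
    (hasMajorant_V0_vPrime b T U blk hη A kQ kF sQ sF c w ρ d₀ δ M₂ α₁ C a₀ hα₁ hδ hM₂ hrepr hlen hsmall hA h337s hρ hd₀
      hd₀0 hw hcard hC ha₀ hkQ hkF hsQ hsF hc)
    (fun k _ => hasMajorant_comm_coefLetter_diffLetter b T U blk η A ρ d₀ δ M₂ α₁ hα₁ hδ hM₂ hrepr h337F h337B hρ hd₀ k)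
  refine hasMajorant_mono (g := toB6 g Rr H) _ h fun y y' => le_of_eq ?_
  rw [Finset.sum_const, Finset.card_univ, Fintype.card_sum, nsmul_eq_mul, Nat.cast_add]
  ring

end Full

/-! ## §4  (3.68)₃ for `P′(A)·D*` with EVERY `V′`-letter hypothesis discharged for the concrete `V′(A)` -/

section Chain

variable {𝔸 : Type*} [NormedRing 𝔸] [NormedAlgebra ℂ 𝔸] [CompleteSpace 𝔸] {ι : Type} [Fintype ι]
variable (b : Module.Basis ι ℝ 𝔸) {S : Type} [Fintype S] {κ : Type} [Fintype κ]
variable (T : κ → Equiv.Perm S) (U : κ → S → 𝔸ˣ)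
variable {g : B9.Geometry} [Fintype g.Site] [DecidableEq g.Site] {Rr : ℝ} {H : Prop}

/-- The summed coefficient constant `c_B = Σ_{k∈κ⊕κ} 2M₂(Σ_i‖b_i‖)e^{δd₀} = 2d·2M₂(Σ_i‖b_i‖)e^{δd₀}` of the concrete `V¹`-letters
(`B9Eq352GradLetters.hasMajorant_coefLetter`), the `c_B` slot of `κ₃₆₈ᴰ`. [cite: Balaban1985BackgroundPropagators, (3.68) p.403 + (3.73) p.405] -/
def cBConc (d : ℕ) (M₂ Sb E₀ : ℝ) : ℝ := 2 * d * (2 * M₂ * Sb * E₀)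

/-- The zeroth-order constant `c_C + Σ_k c_{M,k}` of the divergence form of the full concrete `V′` (`hasMajorant_divForm_zeroth_vPrime`),
the `c_C` slot of `κ₃₆₈ᴰ`. [cite: Balaban1985BackgroundPropagators, (3.68) p.403 + (3.60)–(3.61) p.402] -/
def cCConc (d : ℕ) (ρu α₁ a₀ C M₂ Sb E₀ : ℝ) : ℝ :=
  (((2 + 8 * ρu ^ 2 * α₁) * d + a₀ * C * (2 + C * α₁)) + 4 * d * ρu ^ 2) * M₂ * Sb * E₀

/-- **(3.68)₃ `P′(A)·D* ≺ κ₃₆₈ᴰ·α₁·(Lʲη)⁻¹·e^{−ρd}` WITH ALL FOUR `V′`-LETTER HYPOTHESES DISCHARGED** for the concrete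
`V′(A) = vPrimeConc T U η A …` of (3.60) on the carrier `S × ι` (real coordinates `b`): `B9Ineq368CommSum.ineq368_op_Ds_of_comm_sum`
with `V := conj b V′(A)`, `s := univ : Finset (κ ⊕ κ)`, `hVg := conj_vPrimeConc_eq_gradForm`, `hV0 := hasMajorant_V0_vPrime`,
`hV1 := B9Eq352GradLetters.hasMajorant_coefLetter`, `hComm := B9Eq352GradLetters.hasMajorant_comm_coefLetter_diffLetter`
(constants `cBConc`, `cCConc`; `ρu` = the transport size, `ρ` = the rate).  Every other letter — (3.42)₁,₃ for `G′(U)` (the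
right entries `G′(U)∇_k` per concrete difference letter), (3.42)₃ for `G′(U′U)D*`, the bootstrap `V′(A)G′(U′U)` of (3.63)
type, `Q′`, `Q′*`, `F′₂`, `F′₂*` ((3.19)/(3.59)), `C⁻¹`, `C⁻¹(U′U)`, `C′` ((3.48)/(3.66)/(3.67)), the scale transfers,
(2.54), (2.61) — is the hypothesis it is in `B9Ineq368CommSum` (p. 402 «We assume that Theorem 3.1 is valid for the operator
G′(U)», p. 403 «The remainder can be written explicitly in terms of the operators introduced until now by writing the
expansions of the operators determining P(U′U).» — our unpacking of that list: G′(U), G′(U′U), V′, F′₂, C′).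
[cite: Balaban1985BackgroundPropagators, (3.68) p.403 + (3.60)–(3.61) p.402 + (3.52) p.400 + (3.37) p.396 + (3.42) p.397; Balaban1985RegularSpaces, (1.87) p.91; Balaban1984PropagatorsII, Lemma 2.1 p.234 + (2.51)–(2.55) p.232] -/
theorem ineq368_op_Ds_vPrime (blk : S → g.Site) (d : ℕ) {η : ℝ} (hη : 0 < η) (A : κ → S → 𝔸)
    (kQ kF : g.Site → S → 𝔸 →L[ℝ] 𝔸) (sQ sF : S → 𝔸 →L[ℝ] 𝔸) (c w : g.Site → ℝ) (ρu d₀ M₂ C a₀ : ℝ)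
    (δ₀ δ α β ρ Λ κQ cF cV κC BG BG3 BE BE3 Bc Bc' α₁ : ℝ)
    (hκQ : 0 ≤ κQ) (hcF : 0 ≤ cF) (hcV : 0 ≤ cV) (hκC : 0 ≤ κC) (hBG : 0 ≤ BG) (hBG3 : 0 ≤ BG3) (hBE : 0 ≤ BE)
    (hBE3 : 0 ≤ BE3) (hBc : 0 ≤ Bc) (hBc' : 0 ≤ Bc') (hα₁ : 0 ≤ α₁)
    (hΛ : 1 ≤ Λ) (hρ : 0 ≤ ρ) (hα : 0 ≤ α) (hβ : 0 ≤ β) (hδ₀ : 0 ≤ δ₀) (hδ : 0 ≤ δ)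
    (hr : ρ + 2 * ((2 * α + β) * δ₀) ≤ δ)
    (hdnn : ∀ a a' : g.Site, 0 ≤ g.dist a a') (htri : Triangle254 (toB6 g Rr H)) (hlen : ∀ y : g.Site, 0 < g.len y)
    (h261 : Ineq261 d (toB6 g Rr H) δ₀ β)
    (hT1 : ScaleTransfer g δ₀ α Λ (fun a => g.len a)) (hT1i : ScaleTransfer g δ₀ α Λ (fun a => (g.len a)⁻¹))
    (hT2i : ScaleTransfer g δ₀ α Λ (fun a => (g.len a ^ 2)⁻¹)) (hT4 : ScaleTransfer g δ₀ α Λ (fun a => (g.len a ^ 4)⁻¹))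
    -- the concrete `V′`-letters: (3.37) blockwise, transports, stencil geometry, the averaging kernels
    (hM₂ : 0 ≤ M₂) (hrepr : ∀ (v : 𝔸) (i : ι), |b.repr v i| ≤ M₂ * ‖v‖)
    (hsmall : ∀ y : g.Site, η * (α₁ * (g.len y)⁻¹) ≤ 1 / 4)
    (hA : ∀ μ x, ‖A μ x‖ ≤ α₁ * (g.len (blk x))⁻¹ ∧ ‖tauB T U μ (A μ) x‖ ≤ α₁ * (g.len (blk x))⁻¹)
    (h337s : ∀ μ x, ‖((η : ℂ)⁻¹) • covDstar T U μ (A μ) x‖ ≤ α₁ * (g.len (blk x) ^ 2)⁻¹)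
    (h337F : ∀ μ x, ‖((η : ℂ)⁻¹) • covD T U μ (A μ) x‖ ≤ α₁ * (g.len (blk x) ^ 2)⁻¹)
    (h337B : ∀ μ x, ‖((η : ℂ)⁻¹) • covDstar T U μ (tauB T U μ (A μ)) x‖ ≤ α₁ * (g.len (blk x) ^ 2)⁻¹)
    (hρu : ∀ μ x, ‖((U μ x : 𝔸ˣ) : 𝔸)‖ ≤ ρu ∧ ‖(((U μ x)⁻¹ : 𝔸ˣ) : 𝔸)‖ ≤ ρu)
    (hd₀ : ∀ μ x, g.dist (blk x) (blk (T μ x)) ≤ d₀ ∧ g.dist (blk x) (blk ((T μ).symm x)) ≤ d₀)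
    (hd₀0 : ∀ y : g.Site, g.dist y y ≤ d₀)
    (hw : ∀ y, 0 ≤ w y) (hcard : ∀ y, ((B9Eq360Vprime.block blk y).card : ℝ) * w y ≤ 1) (hC : 0 ≤ C) (ha₀ : 0 ≤ a₀)
    (hkQ : ∀ y x, blk x = y → ‖kQ y x‖ ≤ w y) (hkF : ∀ y x, blk x = y → ‖kF y x‖ ≤ C * α₁ * w y)
    (hsQ : ∀ x, ‖sQ x‖ ≤ 1) (hsF : ∀ x, ‖sF x‖ ≤ C * α₁) (hc : ∀ y, |c y| ≤ a₀ * (g.len y ^ 2)⁻¹)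
    -- the other letters of the chain
    {G E Qs Q Qs' Q' F₂ F₂s Cinv Cinv' Cp Ds : Module.End ℝ (S × ι → ℝ)}
    (h357 : Q' = Q + F₂) (h357s : Qs' = Qs + F₂s)
    (h365 : E = G + G * conj b (vPrimeConc T U η A blk kQ kF sQ sF c) * E)
    (hCC : Cinv' - Cinv = -(Cinv' * Cp * Cinv))
    (hG : HasMajorant (g := toB6 g Rr H) (fun p : S × ι => blk p.1) G
      (fun a a' => BG * g.len a ^ 2 * Real.exp (-(δ * g.dist a a'))))
    (hGD : ∀ k : κ ⊕ κ, HasMajorant (g := toB6 g Rr H) (fun p : S × ι => blk p.1)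
      (G * conj b (diffLetter T U ((η : ℂ)⁻¹) k)) (fun a a' => BG3 * g.len a * Real.exp (-(δ * g.dist a a'))))
    (hEDs : HasMajorant (g := toB6 g Rr H) (fun p : S × ι => blk p.1) (E * Ds)
      (fun a a' => BE3 * g.len a * Real.exp (-(δ * g.dist a a'))))
    (hVE : HasMajorant (g := toB6 g Rr H) (fun p : S × ι => blk p.1)
      (conj b (vPrimeConc T U η A blk kQ kF sQ sF c) * E)
      (fun a a' => cV * α₁ * BE * Real.exp (-(δ * g.dist a a'))))
    (hQ : HasMajorant (g := toB6 g Rr H) (fun p : S × ι => blk p.1) Q (fun a a' : g.Site => if a = a' then κQ else 0))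
    (hQs : HasMajorant (g := toB6 g Rr H) (fun p : S × ι => blk p.1) Qs (fun a a' : g.Site => if a = a' then κQ else 0))
    (hF : HasMajorant (g := toB6 g Rr H) (fun p : S × ι => blk p.1) F₂
      (fun a a' : g.Site => if a = a' then cF * α₁ else 0))
    (hFs : HasMajorant (g := toB6 g Rr H) (fun p : S × ι => blk p.1) F₂s
      (fun a a' : g.Site => if a = a' then cF * α₁ else 0))
    (hCinv : HasMajorant (g := toB6 g Rr H) (fun p : S × ι => blk p.1) Cinv
      (fun a a' => Bc * (g.len a ^ 4)⁻¹ * Real.exp (-(δ * g.dist a a'))))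
    (hCinv' : HasMajorant (g := toB6 g Rr H) (fun p : S × ι => blk p.1) Cinv'
      (fun a a' => Bc' * (g.len a ^ 4)⁻¹ * Real.exp (-(δ * g.dist a a'))))
    (hCp : HasMajorant (g := toB6 g Rr H) (fun p : S × ι => blk p.1) Cp
      (fun a a' => κC * α₁ * g.len a ^ 4 * Real.exp (-(δ * g.dist a a')))) :
    HasMajorant (g := toB6 g Rr H) (fun p : S × ι => blk p.1)
      (B9Eq360Vprime.pPrime G E Qs Qs' Cinv Cinv' Q Q' * Ds)
      (fun a a' => kappa368Ds κQ cF cV κC BG BG3 BG BE BE3 Bc Bc'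
          (cBConc (Fintype.card κ) M₂ (∑ i, ‖b i‖) (Real.exp (δ * d₀)))
          (cCConc (Fintype.card κ) ρu α₁ a₀ C M₂ (∑ i, ‖b i‖) (Real.exp (δ * d₀))) Λ (B6.c1 d δ₀ β) α₁ * α₁ *
        (g.len a)⁻¹ * Real.exp (-(ρ * g.dist a a'))) := by
  have hSb : 0 ≤ ∑ i, ‖b i‖ := Finset.sum_nonneg fun i _ => norm_nonneg _
  have hE₀ : 0 ≤ Real.exp (δ * d₀) := Real.exp_nonneg _
  have hcB : 0 ≤ cBConc (Fintype.card κ) M₂ (∑ i, ‖b i‖) (Real.exp (δ * d₀)) := by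
    unfold cBConc; positivity
  have hcC0 : 0 ≤ ((2 + 8 * ρu ^ 2 * α₁) * Fintype.card κ + a₀ * C * (2 + C * α₁)) * M₂ * (∑ i, ‖b i‖) *
      Real.exp (δ * d₀) := by positivity
  have h := ineq368_op_Ds_of_comm_sum (R := Rr) (H := H) (fun p : S × ι => blk p.1) d
    (Finset.univ : Finset (κ ⊕ κ)) δ₀ δ α β ρ Λ κQ cF cV κC BG BG3 BE BE3 Bc Bc'
    (cBConc (Fintype.card κ) M₂ (∑ i, ‖b i‖) (Real.exp (δ * d₀)))
    (((2 + 8 * ρu ^ 2 * α₁) * Fintype.card κ + a₀ * C * (2 + C * α₁)) * M₂ * (∑ i, ‖b i‖) * Real.exp (δ * d₀)) α₁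
    (fun _ => 2 * M₂ * (∑ i, ‖b i‖) * Real.exp (δ * d₀)) (fun _ => 2 * ρu ^ 2 * M₂ * (∑ i, ‖b i‖) * Real.exp (δ * d₀))
    hκQ hcF hcV hκC hBG hBG3 hBE hBE3 hBc hBc' hcB hcC0 hα₁ hΛ hρ hα hβ hδ₀ hr
    (fun _ _ => by positivity) (le_of_eq ?_) (fun _ _ => by positivity) hdnn htri hlen h261 hT1 hT1i hT2i hT4
    (V1 := fun k => conj b (coefLetter T U A k)) (D := fun k => conj b (diffLetter T U ((η : ℂ)⁻¹) k))
    h357 h357s h365 hCC (conj_vPrimeConc_eq_gradForm b T U η A blk kQ kF sQ sF c) hG (fun k _ => hGD k) hEDs hVE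
    (hasMajorant_V0_vPrime b T U blk hη A kQ kF sQ sF c w ρu d₀ δ M₂ α₁ C a₀ hα₁ hδ hM₂ hrepr hlen hsmall hA h337s hρu
      hd₀ hd₀0 hw hcard hC ha₀ hkQ hkF hsQ hsF hc)
    (fun k _ => hasMajorant_coefLetter b T U blk A d₀ δ M₂ α₁ hα₁ hδ hM₂ hrepr hlen hA hd₀0 k)
    (fun k _ => hasMajorant_comm_coefLetter_diffLetter b T U blk η A ρu d₀ δ M₂ α₁ hα₁ hδ hM₂ hrepr h337F h337B hρu
      hd₀ k)
    hQ hQs hF hFs hCinv hCinv' hCp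
  · have hsum : ((2 + 8 * ρu ^ 2 * α₁) * Fintype.card κ + a₀ * C * (2 + C * α₁)) * M₂ * (∑ i, ‖b i‖) *
          Real.exp (δ * d₀)
        + ∑ _k ∈ (Finset.univ : Finset (κ ⊕ κ)), 2 * ρu ^ 2 * M₂ * (∑ i, ‖b i‖) * Real.exp (δ * d₀)
        = cCConc (Fintype.card κ) ρu α₁ a₀ C M₂ (∑ i, ‖b i‖) (Real.exp (δ * d₀)) := by
      rw [Finset.sum_const, Finset.card_univ, Fintype.card_sum, nsmul_eq_mul, Nat.cast_add, cCConc]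
      ring
    rw [hsum] at h
    exact h
  · rw [Finset.sum_const, Finset.card_univ, Fintype.card_sum, nsmul_eq_mul, Nat.cast_add, cBConc]
    ring

/-- **(v1.1) (3.68)₄ `D·P′(A)·D* ≺ κ₃₆₈ᴰ·α₁·(Lʲη)⁻²·e^{−ρd}` WITH ALL FOUR `V′`-LETTER HYPOTHESES DISCHARGED** — the twin of
`ineq368_op_Ds_vPrime` with a left end letter `D₀` (Theorem 3.1's left entry `D₀G′(U) ≺ B_D Lʲη e^{−δd}`):
`B9Ineq368CommSum.ineq368_op_DDs_of_comm_sum` with `V := conj b V′(A)` and `hVg`/`hV0`/`hV1`/`hComm` supplied by §3 / gen 8.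
[cite: Balaban1985BackgroundPropagators, (3.68) p.403 + (3.60)–(3.61) p.402 + (3.52) p.400 + (3.37) p.396 + (3.42) p.397; Balaban1985RegularSpaces, (1.87) p.91; Balaban1984PropagatorsII, Lemma 2.1 p.234 + (2.51)–(2.55) p.232] -/
theorem ineq368_op_DDs_vPrime (blk : S → g.Site) (d : ℕ) {η : ℝ} (hη : 0 < η) (A : κ → S → 𝔸)
    (kQ kF : g.Site → S → 𝔸 →L[ℝ] 𝔸) (sQ sF : S → 𝔸 →L[ℝ] 𝔸) (c w : g.Site → ℝ) (ρu d₀ M₂ C a₀ : ℝ)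
    (δ₀ δ α β ρ Λ κQ cF cV κC BG BG3 BD BE BE3 Bc Bc' α₁ : ℝ)
    (hκQ : 0 ≤ κQ) (hcF : 0 ≤ cF) (hcV : 0 ≤ cV) (hκC : 0 ≤ κC) (hBG : 0 ≤ BG) (hBG3 : 0 ≤ BG3) (hBD : 0 ≤ BD)
    (hBE : 0 ≤ BE) (hBE3 : 0 ≤ BE3) (hBc : 0 ≤ Bc) (hBc' : 0 ≤ Bc') (hα₁ : 0 ≤ α₁)
    (hΛ : 1 ≤ Λ) (hρ : 0 ≤ ρ) (hα : 0 ≤ α) (hβ : 0 ≤ β) (hδ₀ : 0 ≤ δ₀) (hδ : 0 ≤ δ)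
    (hr : ρ + 2 * ((2 * α + β) * δ₀) ≤ δ)
    (hdnn : ∀ a a' : g.Site, 0 ≤ g.dist a a') (htri : Triangle254 (toB6 g Rr H)) (hlen : ∀ y : g.Site, 0 < g.len y)
    (h261 : Ineq261 d (toB6 g Rr H) δ₀ β)
    (hT1 : ScaleTransfer g δ₀ α Λ (fun a => g.len a)) (hT1i : ScaleTransfer g δ₀ α Λ (fun a => (g.len a)⁻¹))
    (hT2i : ScaleTransfer g δ₀ α Λ (fun a => (g.len a ^ 2)⁻¹)) (hT4 : ScaleTransfer g δ₀ α Λ (fun a => (g.len a ^ 4)⁻¹))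
    (hM₂ : 0 ≤ M₂) (hrepr : ∀ (v : 𝔸) (i : ι), |b.repr v i| ≤ M₂ * ‖v‖)
    (hsmall : ∀ y : g.Site, η * (α₁ * (g.len y)⁻¹) ≤ 1 / 4)
    (hA : ∀ μ x, ‖A μ x‖ ≤ α₁ * (g.len (blk x))⁻¹ ∧ ‖tauB T U μ (A μ) x‖ ≤ α₁ * (g.len (blk x))⁻¹)
    (h337s : ∀ μ x, ‖((η : ℂ)⁻¹) • covDstar T U μ (A μ) x‖ ≤ α₁ * (g.len (blk x) ^ 2)⁻¹)
    (h337F : ∀ μ x, ‖((η : ℂ)⁻¹) • covD T U μ (A μ) x‖ ≤ α₁ * (g.len (blk x) ^ 2)⁻¹)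
    (h337B : ∀ μ x, ‖((η : ℂ)⁻¹) • covDstar T U μ (tauB T U μ (A μ)) x‖ ≤ α₁ * (g.len (blk x) ^ 2)⁻¹)
    (hρu : ∀ μ x, ‖((U μ x : 𝔸ˣ) : 𝔸)‖ ≤ ρu ∧ ‖(((U μ x)⁻¹ : 𝔸ˣ) : 𝔸)‖ ≤ ρu)
    (hd₀ : ∀ μ x, g.dist (blk x) (blk (T μ x)) ≤ d₀ ∧ g.dist (blk x) (blk ((T μ).symm x)) ≤ d₀)
    (hd₀0 : ∀ y : g.Site, g.dist y y ≤ d₀)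
    (hw : ∀ y, 0 ≤ w y) (hcard : ∀ y, ((B9Eq360Vprime.block blk y).card : ℝ) * w y ≤ 1) (hC : 0 ≤ C) (ha₀ : 0 ≤ a₀)
    (hkQ : ∀ y x, blk x = y → ‖kQ y x‖ ≤ w y) (hkF : ∀ y x, blk x = y → ‖kF y x‖ ≤ C * α₁ * w y)
    (hsQ : ∀ x, ‖sQ x‖ ≤ 1) (hsF : ∀ x, ‖sF x‖ ≤ C * α₁) (hc : ∀ y, |c y| ≤ a₀ * (g.len y ^ 2)⁻¹)
    {G D₀ E Qs Q Qs' Q' F₂ F₂s Cinv Cinv' Cp Ds : Module.End ℝ (S × ι → ℝ)}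
    (h357 : Q' = Q + F₂) (h357s : Qs' = Qs + F₂s)
    (h365 : E = G + G * conj b (vPrimeConc T U η A blk kQ kF sQ sF c) * E)
    (hCC : Cinv' - Cinv = -(Cinv' * Cp * Cinv))
    (hG : HasMajorant (g := toB6 g Rr H) (fun p : S × ι => blk p.1) G
      (fun a a' => BG * g.len a ^ 2 * Real.exp (-(δ * g.dist a a'))))
    (hDG : HasMajorant (g := toB6 g Rr H) (fun p : S × ι => blk p.1) (D₀ * G)
      (fun a a' => BD * g.len a * Real.exp (-(δ * g.dist a a'))))
    (hGD : ∀ k : κ ⊕ κ, HasMajorant (g := toB6 g Rr H) (fun p : S × ι => blk p.1)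
      (G * conj b (diffLetter T U ((η : ℂ)⁻¹) k)) (fun a a' => BG3 * g.len a * Real.exp (-(δ * g.dist a a'))))
    (hEDs : HasMajorant (g := toB6 g Rr H) (fun p : S × ι => blk p.1) (E * Ds)
      (fun a a' => BE3 * g.len a * Real.exp (-(δ * g.dist a a'))))
    (hVE : HasMajorant (g := toB6 g Rr H) (fun p : S × ι => blk p.1)
      (conj b (vPrimeConc T U η A blk kQ kF sQ sF c) * E)
      (fun a a' => cV * α₁ * BE * Real.exp (-(δ * g.dist a a'))))
    (hQ : HasMajorant (g := toB6 g Rr H) (fun p : S × ι => blk p.1) Q (fun a a' : g.Site => if a = a' then κQ else 0))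
    (hQs : HasMajorant (g := toB6 g Rr H) (fun p : S × ι => blk p.1) Qs (fun a a' : g.Site => if a = a' then κQ else 0))
    (hF : HasMajorant (g := toB6 g Rr H) (fun p : S × ι => blk p.1) F₂
      (fun a a' : g.Site => if a = a' then cF * α₁ else 0))
    (hFs : HasMajorant (g := toB6 g Rr H) (fun p : S × ι => blk p.1) F₂s
      (fun a a' : g.Site => if a = a' then cF * α₁ else 0))
    (hCinv : HasMajorant (g := toB6 g Rr H) (fun p : S × ι => blk p.1) Cinv
      (fun a a' => Bc * (g.len a ^ 4)⁻¹ * Real.exp (-(δ * g.dist a a'))))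
    (hCinv' : HasMajorant (g := toB6 g Rr H) (fun p : S × ι => blk p.1) Cinv'
      (fun a a' => Bc' * (g.len a ^ 4)⁻¹ * Real.exp (-(δ * g.dist a a'))))
    (hCp : HasMajorant (g := toB6 g Rr H) (fun p : S × ι => blk p.1) Cp
      (fun a a' => κC * α₁ * g.len a ^ 4 * Real.exp (-(δ * g.dist a a')))) :
    HasMajorant (g := toB6 g Rr H) (fun p : S × ι => blk p.1)
      (D₀ * B9Eq360Vprime.pPrime G E Qs Qs' Cinv Cinv' Q Q' * Ds)
      (fun a a' => kappa368Ds κQ cF cV κC BG BG3 BD BE BE3 Bc Bc'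
          (cBConc (Fintype.card κ) M₂ (∑ i, ‖b i‖) (Real.exp (δ * d₀)))
          (cCConc (Fintype.card κ) ρu α₁ a₀ C M₂ (∑ i, ‖b i‖) (Real.exp (δ * d₀))) Λ (B6.c1 d δ₀ β) α₁ * α₁ *
        (g.len a ^ 2)⁻¹ * Real.exp (-(ρ * g.dist a a'))) := by
  have hSb : 0 ≤ ∑ i, ‖b i‖ := Finset.sum_nonneg fun i _ => norm_nonneg _
  have hE₀ : 0 ≤ Real.exp (δ * d₀) := Real.exp_nonneg _
  have hcB : 0 ≤ cBConc (Fintype.card κ) M₂ (∑ i, ‖b i‖) (Real.exp (δ * d₀)) := by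
    unfold cBConc; positivity
  have hcC0 : 0 ≤ ((2 + 8 * ρu ^ 2 * α₁) * Fintype.card κ + a₀ * C * (2 + C * α₁)) * M₂ * (∑ i, ‖b i‖) *
      Real.exp (δ * d₀) := by positivity
  have h := ineq368_op_DDs_of_comm_sum (R := Rr) (H := H) (fun p : S × ι => blk p.1) d
    (Finset.univ : Finset (κ ⊕ κ)) δ₀ δ α β ρ Λ κQ cF cV κC BG BG3 BD BE BE3 Bc Bc'
    (cBConc (Fintype.card κ) M₂ (∑ i, ‖b i‖) (Real.exp (δ * d₀)))
    (((2 + 8 * ρu ^ 2 * α₁) * Fintype.card κ + a₀ * C * (2 + C * α₁)) * M₂ * (∑ i, ‖b i‖) * Real.exp (δ * d₀)) α₁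
    (fun _ => 2 * M₂ * (∑ i, ‖b i‖) * Real.exp (δ * d₀)) (fun _ => 2 * ρu ^ 2 * M₂ * (∑ i, ‖b i‖) * Real.exp (δ * d₀))
    hκQ hcF hcV hκC hBG hBG3 hBD hBE hBE3 hBc hBc' hcB hcC0 hα₁ hΛ hρ hα hβ hδ₀ hr
    (fun _ _ => by positivity) (le_of_eq ?_) (fun _ _ => by positivity) hdnn htri hlen h261 hT1 hT1i hT2i hT4
    (V1 := fun k => conj b (coefLetter T U A k)) (D := fun k => conj b (diffLetter T U ((η : ℂ)⁻¹) k))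
    h357 h357s h365 hCC (conj_vPrimeConc_eq_gradForm b T U η A blk kQ kF sQ sF c) hG hDG (fun k _ => hGD k) hEDs hVE
    (hasMajorant_V0_vPrime b T U blk hη A kQ kF sQ sF c w ρu d₀ δ M₂ α₁ C a₀ hα₁ hδ hM₂ hrepr hlen hsmall hA h337s hρu
      hd₀ hd₀0 hw hcard hC ha₀ hkQ hkF hsQ hsF hc)
    (fun k _ => hasMajorant_coefLetter b T U blk A d₀ δ M₂ α₁ hα₁ hδ hM₂ hrepr hlen hA hd₀0 k)
    (fun k _ => hasMajorant_comm_coefLetter_diffLetter b T U blk η A ρu d₀ δ M₂ α₁ hα₁ hδ hM₂ hrepr h337F h337B hρu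
      hd₀ k)
    hQ hQs hF hFs hCinv hCinv' hCp
  · have hsum : ((2 + 8 * ρu ^ 2 * α₁) * Fintype.card κ + a₀ * C * (2 + C * α₁)) * M₂ * (∑ i, ‖b i‖) *
          Real.exp (δ * d₀)
        + ∑ _k ∈ (Finset.univ : Finset (κ ⊕ κ)), 2 * ρu ^ 2 * M₂ * (∑ i, ‖b i‖) * Real.exp (δ * d₀)
        = cCConc (Fintype.card κ) ρu α₁ a₀ C M₂ (∑ i, ‖b i‖) (Real.exp (δ * d₀)) := by
      rw [Finset.sum_const, Finset.card_univ, Fintype.card_sum, nsmul_eq_mul, Nat.cast_add, cCConc]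
      ring
    rw [hsum] at h
    exact h
  · rw [Finset.sum_const, Finset.card_univ, Fintype.card_sum, nsmul_eq_mul, Nat.cast_add, cBConc]
    ring

end Chain

end Literature.MathematicalPhysics.QuantumFieldTheory.Balaban1983to89.B9Eq360VprimeLetters
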